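import Literature.AlgebraicGeometry.GroupSchemes.EtaleClosureOfFiniteSubgroupOfSections   -- ★ p844902 (B-p12 g30): unit components, sections, étale closure (brings ★ p844860, ★ p844805, ★ p844780)
import Literature.AlgebraicGeometry.GroupSchemes.HopfIdealOfClosedSubgroup                -- ★ p845070∕p845077∕p845127 (B-p12 g31): ideal of a closed subgroup, points criteria
import Literature.AlgebraicGeometry.Morphisms.ClosedImmersionOfEqualRank                   -- ★ (o-c2c): equal-rank rigidity `Over.isIso_of_isClosedImmersion_of_finrank_eq`
import Mathlib.RingTheory.Flat.TorsionFree
import HarnessLib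

/-!
# The canonical subgroup of points: the closure of the points of the unit component is the unit component, the closure of a
# finite subgroup meeting it trivially is étale (Serre–Tate 1968 §1; Tate, *Finite flat group schemes* (3.7); Katz, *p-adic
# properties of modular schemes and modular forms* §3 «canonical subgroup» over `𝒪_Ω`)

Layer `Literature/AlgebraicGeometry/GroupSchemes`, namespace `Literature.AlgebraicGeometry.GroupSchemes.AffineGroupScheme` (continues ★
`HopfIdealOfFiniteSubgroupOfPoints` ∕ `HopfIdealOfClosedSubgroup` ∕ `FiniteSubgroupOfSections`).  THEOREMS ONLY (no definition, no instance,
no notation, no named fact, no `sorry`).  Cell `hodgecm-mathlib` (D-0151), programme P6 «MOD», DICT-constructor organ **(K-b4) «CANONICAL-LINE»**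
of F0P6c-plan (g2) (2026-09-01 15:45Z), feeding the (b4′) `canonicalLine` constructor: among the order-`q` stable subgroups of `𝒢(V) = 𝒢(Ω)`
exactly ONE — `C_can = ker (reduction) = 𝒢⁰(V)` — specialises to the unit component `(𝒢_κ̄)⁰ = ker F`; all the others have ÉTALE closure.
Count-neutral Mathlib-side capital: HC_CM is proved only modulo the printed citations until rung 0 closes; nothing here bears on it.

THE CURRENCY (one notion of closure throughout).  `R` a commutative ring, `G` an AFFINE group object of `SchemeOver R`, `A := Alg G`,
`u : J → (specOver R R ⟶ G)` a finite family of `R`-points.  The POINTS IDEAL of `u` is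
`I_u := RingHom.ker (AlgHom.pi fun i => ptEquiv G R (u i)) = ⋂ᵢ ker φ_{uᵢ}` (★ `HopfIdealOfFiniteSubgroupOfPoints`), and the (schematic)
CLOSURE of `u` is the closed subscheme `quotIncl G I_u : Spec (A ⧸ I_u) ↪ G` (★ `HopfIdealClosedSubgroup.quotIncl`) — the `Cbar` INSIDE ★
`exists_etale_closedSubgroup_of_points`.  For a unit component `j : G₀ ↪ G` (homomorphic open-and-closed immersion, `G₀` connected —
P6b's `IsUnitComponent`, unbundled) THIS FILE PROVES:

* §1 `ker Γ(j) ≤ I_u` when every `uᵢ` lies in `G₀`, hence the closure FACTORS through `j` by a closed immersion `v : Spec (A ⧸ I_u) ⟶ G₀`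
  (`exists_hom_comp_eq_quotIncl_of_forall`; ★ p845070 points criterion);
* §2 over a VALUATION RING `R` (record: `V = 𝒪_Ω ⊂ Ω`): `A ⧸ I_u ↪ R^J` is torsion-free, hence FLAT and FREE (Mathlib
  `flat_iff_torsion_eq_bot_of_isBezout`, `free_of_flat_of_isLocalRing`), of rank `|J|` when the `uᵢ` are pairwise distinct (the evaluation
  map is surjective after `⊗ K`, CRT over the fraction field), so the closure is finite flat of rank `|J|` at every point of `Spec R`
  (`finrank_quotIncl_pointsIdeal_hom`);
* §3 **`exists_iso_quotIncl_pointsIdeal_of_unitComponent`** — (i) of the deal: if moreover `G₀ → Spec R` is (finite) flat of rank `|J|`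
  and all `uᵢ ∈ G₀(R)`, then `Spec (A ⧸ I_u) ≅ G₀` OVER `G` (equal-rank rigidity ★ `Over.isIso_of_isClosedImmersion_of_finrank_eq`): «the
  closure of the points of the unit component is the unit component» (`C_can ↦ 𝒢⁰`, whose special fibre is `(𝒢_κ̄)⁰` by ★ P6b (b1g));
* §4 **`etale_quotIncl_pointsIdeal_of_subgroup`** — (ii): over a HENSELIAN local `R`, for the points of a finite SUBGROUP `C` of sections meeting
  `G₀(R)` trivially, the closure is FINITE ÉTALE, its ideal is a Hopf ideal and its `R`-points are exactly `C` (★ `exists_etale_closedSubgroup`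
  with the witness exposed);
* §5 (iii) DICHOTOMY `not_etale_of_iso_unitComponent` ∕ `card_eq_one_of_etale_of_connected`: a CONNECTED finite étale `R`-scheme with a section over
  a local `R` is `≅ Spec R` (rank `1`), so for `|J| ≥ 2` the closure of §3 is NOT étale — «`C = C_can` ↔ closure not étale ↔ (with (b1g))
  special fibre `= (𝒢_κ̄)⁰`».

## References
* [SerreTate1968] J.-P. Serre, J. Tate, *Good reduction of abelian varieties*, Ann. of Math. 88 (1968) — §1, Lemma 1 (reduction is injective on
  torsion prime to… ∕ the kernel of reduction is the formal group's points).
* [Tate1997FiniteFlatGroupSchemes] J. Tate, *Finite flat group schemes*, in: Modular Forms and Fermat's Last Theorem (1997) — (3.7)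
  (connected–étale sequence over a henselian local ring; `G⁰(R)` = points reducing to the unit).
* [Katz1973] N. M. Katz, *p-adic properties of modular schemes and modular forms*, LNM 350 (1973) — §3.1, Thm. 3.1
  («canonical subgroup» = the subgroup of points of `E[p]` lying in the formal group over `𝒪`; cited for the name and the dichotomy).
* [StacksProject] Tag 02KA (closed immersion of finite flat of equal rank is an iso), Tag 04GG (finite algebras over henselian local rings).
-/

set_option autoImplicit false

-- Mathlib's `Over`/`Scheme` APIs are stated across semireducible wrappers (as in the ★ `GroupSchemes/*` files).
set_option backward.isDefEq.respectTransparency false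

universe u

open CategoryTheory CategoryTheory.Limits AlgebraicGeometry MonoidalCategory CartesianMonoidalCategory TensorProduct IsLocalRing

noncomputable section

namespace Literature.AlgebraicGeometry.GroupSchemes

namespace AffineGroupScheme

open scoped MonObj

open Literature.AlgebraicGeometry.Motives Literature.AlgebraicGeometry.Morphisms

variable {R : Type u} [CommRing R]

/-! ## §1 The closure of points of the unit component factors through the unit component -/

section Factor

variable {G G₀ : SchemeOver R} [IsAffine G.left] [IsAffine G₀.left] (j : G₀ ⟶ G) {J : Type u} (u : J → (specOver R R ⟶ G))

/-- **`ker Γ(j) ≤ I_u`** when every point `uᵢ` lies in `G₀`: a function vanishing on `G₀` vanishes at points of `G₀` (★ p845070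
`le_ker_ptEquiv_comp_of_hom`). [cite: Tate1997FiniteFlatGroupSchemes, (3.7)] -/
theorem ker_le_ker_pi_ptEquiv_of_forall (hu : ∀ i, ∃ v : specOver R R ⟶ G₀, v ≫ j = u i) :
    RingHom.ker (ptEquiv G (Alg G₀) ((isoSpecOver G₀).inv ≫ j)).toRingHom ≤
      RingHom.ker (AlgHom.pi fun i => ptEquiv G R (u i) : Alg G →ₐ[R] (J → R)).toRingHom := by
  intro a ha
  rw [RingHom.mem_ker, AlgHom.toRingHom_eq_coe, AlgHom.coe_toRingHom]
  funext i
  obtain ⟨v, hv⟩ := hu i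
  rw [AlgHom.pi_apply, ← hv]
  exact le_ker_ptEquiv_comp_of_hom j v ha

/-- **The closure of points of `G₀` FACTORS THROUGH `j`**: there is `v : Spec (A ⧸ I_u) ⟶ G₀` over `R` with `v ≫ j = quotIncl G I_u`, and
`v.left` is a closed immersion (★ p845070 `exists_comp_eq_of_le_ker` at the tautological point of the closure; Mathlib
`IsClosedImmersion.of_comp_isClosedImmersion`). [cite: Tate1997FiniteFlatGroupSchemes, (3.7)] [cite: StacksProject, Tag 02KA] -/
theorem exists_hom_comp_eq_quotIncl_of_forall [IsClosedImmersion j.left] (hu : ∀ i, ∃ v : specOver R R ⟶ G₀, v ≫ j = u i) :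
    ∃ v : specOver R (Alg G ⧸ RingHom.ker (AlgHom.pi fun i => ptEquiv G R (u i) : Alg G →ₐ[R] (J → R)).toRingHom) ⟶ G₀,
      v ≫ j = quotIncl G (RingHom.ker (AlgHom.pi fun i => ptEquiv G R (u i) : Alg G →ₐ[R] (J → R)).toRingHom) ∧
        IsClosedImmersion v.left := by
  set I := RingHom.ker (AlgHom.pi fun i => ptEquiv G R (u i) : Alg G →ₐ[R] (J → R)).toRingHom with hI
  have hle : RingHom.ker (ptEquiv G (Alg G₀) ((isoSpecOver G₀).inv ≫ j)).toRingHom ≤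
      RingHom.ker (ptEquiv G (Alg G ⧸ I) (quotIncl G I)).toRingHom := by
    intro a ha
    rw [RingHom.mem_ker, AlgHom.toRingHom_eq_coe, AlgHom.coe_toRingHom, ptEquiv_quotIncl, Ideal.Quotient.mkₐ_eq_mk,
      Ideal.Quotient.eq_zero_iff_mem]
    exact ker_le_ker_pi_ptEquiv_of_forall j u hu ha
  obtain ⟨v, hv⟩ := exists_comp_eq_of_le_ker j (quotIncl G I) hle
  haveI : IsClosedImmersion (v ≫ j).left := by rw [hv]; exact isClosedImmersion_quotIncl_left G I
  haveI : IsClosedImmersion (v.left ≫ j.left) := by rw [← Over.comp_left]; infer_instance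
  exact ⟨v, hv, IsClosedImmersion.of_comp_isClosedImmersion v.left j.left⟩

end Factor

/-! ## §2 Over a valuation ring the closure of a finite family of distinct points is finite flat of rank `|J|` -/

section Rank

variable (G : SchemeOver R) [IsAffine G.left] {J : Type u} (u : J → (specOver R R ⟶ G))

/-- `A ⧸ I_u ↪ R^J` is torsion-free: `torsion_R (A ⧸ I_u) = ⊥` over a domain. [cite: Tate1997FiniteFlatGroupSchemes, (3.7)] -/
theorem torsion_quotient_ker_pi_ptEquiv_eq_bot [IsDomain R] :
    Submodule.torsion R (Alg G ⧸ RingHom.ker (AlgHom.pi fun i => ptEquiv G R (u i) : Alg G →ₐ[R] (J → R)).toRingHom) = ⊥ := by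
  rw [eq_bot_iff]
  intro x hx
  obtain ⟨⟨r, hr⟩, hrx⟩ := (Submodule.mem_torsion_iff x).mp hx
  obtain ⟨a, rfl⟩ := Ideal.Quotient.mk_surjective x
  rw [Submodule.mem_bot, Ideal.Quotient.eq_zero_iff_mem, RingHom.mem_ker, AlgHom.toRingHom_eq_coe, AlgHom.coe_toRingHom]
  change (⟨r, hr⟩ : nonZeroDivisors R) • Ideal.Quotient.mk _ a = 0 at hrx
  rw [Submonoid.mk_smul, ← Ideal.Quotient.mkₐ_eq_mk R, ← map_smul, Ideal.Quotient.mkₐ_eq_mk, Ideal.Quotient.eq_zero_iff_mem,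
    RingHom.mem_ker, AlgHom.toRingHom_eq_coe, AlgHom.coe_toRingHom, map_smul] at hrx
  funext i
  have h := congr_fun hrx i
  rw [Pi.smul_apply, Pi.zero_apply, smul_eq_mul] at h
  rw [Pi.zero_apply]
  exact (mul_eq_zero.mp h).resolve_left (nonZeroDivisors.ne_zero hr)

/-- Over a VALUATION ring, `A ⧸ I_u` is FLAT (torsion-free over a Bézout domain, Mathlib `flat_iff_torsion_eq_bot_of_isBezout`).
[cite: StacksProject, Tag 0539] [cite: Tate1997FiniteFlatGroupSchemes, (3.7)] -/
theorem flat_quotient_ker_pi_ptEquiv [IsDomain R] [ValuationRing R] :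
    Module.Flat R (Alg G ⧸ RingHom.ker (AlgHom.pi fun i => ptEquiv G R (u i) : Alg G →ₐ[R] (J → R)).toRingHom) :=
  Module.Flat.flat_iff_torsion_eq_bot_of_isBezout.mpr (torsion_quotient_ker_pi_ptEquiv_eq_bot G u)

/-- `A ⧸ I_u` is module-finite over `R` when `G → Spec R` is finite. [cite: Tate1997FiniteFlatGroupSchemes, (3.7)] -/
theorem finite_quotient_ker_pi_ptEquiv [IsFinite G.hom] :
    Module.Finite R (Alg G ⧸ RingHom.ker (AlgHom.pi fun i => ptEquiv G R (u i) : Alg G →ₐ[R] (J → R)).toRingHom) := by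
  haveI := Alg.moduleFinite G
  exact Module.Finite.of_surjective (Ideal.Quotient.mkₐ R _).toLinearMap Ideal.Quotient.mk_surjective

/-- Over a valuation ring, `A ⧸ I_u` is FREE of finite rank (finite flat over a local ring). [cite: StacksProject, Tag 0539] -/
theorem free_quotient_ker_pi_ptEquiv [IsDomain R] [ValuationRing R] [IsFinite G.hom] :
    Module.Free R (Alg G ⧸ RingHom.ker (AlgHom.pi fun i => ptEquiv G R (u i) : Alg G →ₐ[R] (J → R)).toRingHom) := by
  haveI := flat_quotient_ker_pi_ptEquiv G u
  haveI := finite_quotient_ker_pi_ptEquiv G u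
  exact Module.free_of_flat_of_isLocalRing

/-- **Distinct points of `G` give DISTINCT GENERIC POINTS**: for `uᵢ ≠ uₖ`, the `K`-points `K ⊗ Γ(G) → K` (`K = Frac R`) obtained by
extending `φ_{uᵢ}`, `φ_{uₖ}` have different kernels. [cite: StacksProject, Tag 00DT] -/
theorem ker_lift_ne_of_ne [IsDomain R] {K : Type u} [Field K] [Algebra R K] [IsFractionRing R K] (hu : Function.Injective u) {i k : J}
    (hik : i ≠ k) :
    RingHom.ker (Algebra.TensorProduct.lift (AlgHom.id K K) ((Algebra.ofId R K).comp (ptEquiv G R (u i))) fun _ _ => Commute.all _ _) ≠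
      RingHom.ker (Algebra.TensorProduct.lift (AlgHom.id K K) ((Algebra.ofId R K).comp (ptEquiv G R (u k)))
        fun _ _ => Commute.all _ _) := by
  intro h
  apply hik
  apply hu
  apply (ptEquiv G R).injective
  refine AlgHom.ext fun a => ?_
  -- `x := 1 ⊗ a − φᵢ(a) ⊗ 1` lies in the first kernel, hence in the second
  have hx : (1 : K) ⊗ₜ[R] a - algebraMap R K (ptEquiv G R (u i) a) ⊗ₜ[R] (1 : Alg G) ∈
      RingHom.ker (Algebra.TensorProduct.lift (AlgHom.id K K) ((Algebra.ofId R K).comp (ptEquiv G R (u i))) fun _ _ => Commute.all _ _) := by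
    rw [RingHom.mem_ker, map_sub, Algebra.TensorProduct.lift_tmul, Algebra.TensorProduct.lift_tmul]
    simp only [AlgHom.id_apply, AlgHom.comp_apply, Algebra.ofId_apply, map_one, one_mul, mul_one, sub_self]
  rw [h, RingHom.mem_ker, map_sub, Algebra.TensorProduct.lift_tmul, Algebra.TensorProduct.lift_tmul] at hx
  simp only [AlgHom.id_apply, AlgHom.comp_apply, Algebra.ofId_apply, map_one, one_mul, mul_one, sub_eq_zero] at hx
  exact (IsFractionRing.injective R K hx).symm

/-- **The evaluation map is surjective after `⊗ K`** (CRT over the fraction field: distinct points have distinct, hence comaximal,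
kernels; ★ `surjective_pi_of_pairwise_comap_maximalIdeal_ne` at the field `K`). [cite: StacksProject, Tag 00DT] -/
theorem surjective_pi_lift_of_injective [IsDomain R] {K : Type u} [Field K] [Algebra R K] [IsFractionRing R K] [Finite J]
    (hu : Function.Injective u) :
    Function.Surjective (AlgHom.pi fun i =>
      (Algebra.TensorProduct.lift (AlgHom.id K K) ((Algebra.ofId R K).comp (ptEquiv G R (u i))) fun _ _ => Commute.all _ _ :
        K ⊗[R] Alg G →ₐ[K] K)) := by
  have h𝔪 : maximalIdeal K = ⊥ := IsLocalRing.isField_iff_maximalIdeal_eq.mp (Field.toIsField K)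
  refine Literature.RingTheory.Ideal.surjective_pi_of_pairwise_comap_maximalIdeal_ne _ fun i k hik => ?_
  change Ideal.comap _ (maximalIdeal K) ≠ Ideal.comap _ (maximalIdeal K)
  rw [h𝔪, ← RingHom.ker_eq_comap_bot, ← RingHom.ker_eq_comap_bot]
  exact ker_lift_ne_of_ne G u hu hik

/-- **RANK OF THE CLOSURE = NUMBER OF POINTS**: over a valuation ring `R`, for pairwise distinct points `uᵢ` of a finite `G`,
`rank_R (A ⧸ I_u) = |J|` (`K ⊗_R (A ⧸ I_u) ≅ K^J`: injective by flatness of `K` and `A ⧸ I_u ↪ R^J`, surjective by CRT).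
[cite: Tate1997FiniteFlatGroupSchemes, (3.7)] [cite: StacksProject, Tag 00DT] -/
theorem finrank_quotient_ker_pi_ptEquiv [IsDomain R] [ValuationRing R] [IsFinite G.hom] [Finite J] (hu : Function.Injective u) :
    Module.finrank R (Alg G ⧸ RingHom.ker (AlgHom.pi fun i => ptEquiv G R (u i) : Alg G →ₐ[R] (J → R)).toRingHom) = Nat.card J := by
  classical
  set π : Alg G →ₐ[R] (J → R) := AlgHom.pi fun i => ptEquiv G R (u i) with hπ
  haveI := free_quotient_ker_pi_ptEquiv G u
  haveI : Module.Flat R (FractionRing R) := IsLocalization.flat (FractionRing R) (nonZeroDivisors R)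
  cases nonempty_fintype J
  -- the injective `R`-linear map `A ⧸ I ↪ R^J` and its flat base change to `K`
  let incl : (Alg G ⧸ RingHom.ker π.toRingHom) →ₗ[R] (J → R) := (Ideal.kerLiftAlg π).toLinearMap
  have hincl : Function.Injective incl := Ideal.kerLiftAlg_injective π
  let θ : FractionRing R ⊗[R] (Alg G ⧸ RingHom.ker π.toRingHom) →ₗ[FractionRing R] (J → FractionRing R) :=
    (TensorProduct.piScalarRight R (FractionRing R) (FractionRing R) J).toLinearMap ∘ₗ incl.baseChange (FractionRing R)
  have hθinj : Function.Injective θ := by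
    refine (TensorProduct.piScalarRight R (FractionRing R) (FractionRing R) J).injective.comp ?_
    rw [LinearMap.baseChange_eq_ltensor]
    exact Module.Flat.lTensor_preserves_injective_linearMap incl hincl
  -- `θ ∘ (K ⊗ mk) = Π` on `K ⊗ A`, so `θ` is onto (CRT surjectivity of `Π`)
  have hθsurj : Function.Surjective θ := by
    intro g
    obtain ⟨x, hx⟩ := surjective_pi_lift_of_injective G u (K := FractionRing R) hu g
    refine ⟨(Ideal.Quotient.mkₐ R (RingHom.ker π.toRingHom)).toLinearMap.baseChange (FractionRing R) x, ?_⟩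
    rw [← hx]
    clear hx
    induction x using TensorProduct.induction_on with
    | zero => simp only [map_zero]
    | tmul c a =>
      funext i
      rw [LinearMap.baseChange_tmul, AlgHom.toLinearMap_apply, Ideal.Quotient.mkₐ_eq_mk]
      change (TensorProduct.piScalarRight R (FractionRing R) (FractionRing R) J) (incl.baseChange (FractionRing R) (c ⊗ₜ _)) i = _
      rw [LinearMap.baseChange_tmul, TensorProduct.piScalarRight_apply, TensorProduct.piScalarRightHom_tmul, AlgHom.pi_apply,
        Algebra.TensorProduct.lift_tmul, AlgHom.id_apply, AlgHom.comp_apply, Algebra.ofId_apply]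
      change incl (Ideal.Quotient.mk _ a) i • c = _
      have hincla : incl (Ideal.Quotient.mk _ a) = π a := Ideal.kerLiftAlg_mk π a
      rw [hincla, hπ, AlgHom.pi_apply, Algebra.smul_def, mul_comm]
    | add x y hx hy => rw [map_add, map_add, map_add, hx, hy]
  have e : (FractionRing R ⊗[R] (Alg G ⧸ RingHom.ker π.toRingHom)) ≃ₗ[FractionRing R] (J → FractionRing R) :=
    LinearEquiv.ofBijective θ ⟨hθinj, hθsurj⟩
  rw [← Module.finrank_baseChange (R := FractionRing R), e.finrank_eq, Module.finrank_fintype_fun_eq_card, Nat.card_eq_fintype_card]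

end Rank

/-! ## §3 (i) The closure of the points of the unit component IS the unit component -/

section Canonical

variable [IsDomain R] [ValuationRing R] {G G₀ : SchemeOver R} [IsAffine G.left] [IsAffine G₀.left]
  (j : G₀ ⟶ G) [IsClosedImmersion j.left] [IsFinite G₀.hom] [Flat G₀.hom] {J : Type u} (u : J → (specOver R R ⟶ G))

/-- The closure `Spec (A ⧸ I_u) → Spec R` is FLAT (over a valuation ring). [cite: StacksProject, Tag 0539] -/
theorem flat_specOver_quotient_ker_pi_ptEquiv_hom :
    Flat (specOver R (Alg G ⧸ RingHom.ker (AlgHom.pi fun i => ptEquiv G R (u i) : Alg G →ₐ[R] (J → R)).toRingHom)).hom := by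
  haveI := flat_quotient_ker_pi_ptEquiv G u
  change Flat (Spec.map (CommRingCat.ofHom (algebraMap R _)))
  rw [Flat.SpecMap_iff, CommRingCat.hom_ofHom, RingHom.flat_algebraMap_iff]
  infer_instance

omit [IsDomain R] [ValuationRing R] in
/-- The closure `Spec (A ⧸ I_u) → Spec R` is FINITE. [cite: Tate1997FiniteFlatGroupSchemes, (3.7)] -/
theorem isFinite_specOver_quotient_ker_pi_ptEquiv_hom [IsFinite G.hom] :
    IsFinite (specOver R (Alg G ⧸ RingHom.ker (AlgHom.pi fun i => ptEquiv G R (u i) : Alg G →ₐ[R] (J → R)).toRingHom)).hom := by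
  haveI := finite_quotient_ker_pi_ptEquiv G u
  change IsFinite (Spec.map (CommRingCat.ofHom (algebraMap R _)))
  rw [IsFinite.SpecMap_iff, CommRingCat.hom_ofHom, RingHom.finite_algebraMap]
  infer_instance

/-- **The closure of `|J|` pairwise distinct points has rank `|J|` at EVERY point of `Spec R`** (`R` a valuation ring: the rank function
of the finite free `A ⧸ I_u` is the constant `finrank`). [cite: Tate1997FiniteFlatGroupSchemes, (3.7)] [cite: StacksProject, Tag 02KA] -/
theorem finrank_specOver_quotient_ker_pi_ptEquiv_hom [IsFinite G.hom] [Finite J] (hu : Function.Injective u) (s : Spec (CommRingCat.of R)) :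
    (specOver R (Alg G ⧸ RingHom.ker (AlgHom.pi fun i => ptEquiv G R (u i) : Alg G →ₐ[R] (J → R)).toRingHom)).hom.finrank s =
      Nat.card J := by
  haveI := finite_quotient_ker_pi_ptEquiv G u
  haveI := flat_quotient_ker_pi_ptEquiv G u
  change Scheme.Hom.finrank (Spec.map (CommRingCat.ofHom (algebraMap R _))) s = _
  rw [Scheme.Hom.finrank_SpecMap_algebraMap, rankAtStalk_eq_finrank_of_isLocalRing, finrank_quotient_ker_pi_ptEquiv G u hu]

/-- **(i) THE CLOSURE OF THE POINTS OF THE UNIT COMPONENT IS THE UNIT COMPONENT.**  `R` a valuation ring (record: `V = 𝒪_Ω`), `G` finite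
affine over `Spec R`, `j : G₀ ↪ G` a closed subscheme finite flat of rank `|J|` at every point (the unit component, rank `q`), and
`u : J ↪ G(R)` pairwise distinct points ALL IN `G₀` (record: `C_can = G₀(V) = ker (reduction)`, `|C_can| = q`): then the closure
`Spec (A ⧸ I_u) ↪ G` IS `G₀` — an isomorphism `e` over `G` (`e.hom ≫ j = quotIncl G I_u`; §1 factorisation + §2 rank + ★ Tag 02KA equal-rank
rigidity).  With ★ P6b (b1g) its special fibre is the unit component `(G_κ̄)⁰` («`sp C_can = ker F`»).
[cite: SerreTate1968, §1 Lemma 1] [cite: Katz1973, §3.1 Thm. 3.1] [cite: StacksProject, Tag 02KA] -/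
theorem exists_iso_quotIncl_pointsIdeal_of_unitComponent [IsFinite G.hom] [Finite J] (hu : Function.Injective u)
    (hG₀ : ∀ i, ∃ v : specOver R R ⟶ G₀, v ≫ j = u i)
    (hrk : ∀ s, G₀.hom.finrank s = Nat.card J) :
    ∃ e : specOver R (Alg G ⧸ RingHom.ker (AlgHom.pi fun i => ptEquiv G R (u i) : Alg G →ₐ[R] (J → R)).toRingHom) ≅ G₀,
      e.hom ≫ j = quotIncl G (RingHom.ker (AlgHom.pi fun i => ptEquiv G R (u i) : Alg G →ₐ[R] (J → R)).toRingHom) := by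
  obtain ⟨v, hv, hvci⟩ := exists_hom_comp_eq_quotIncl_of_forall j u hG₀
  haveI := hvci
  haveI := flat_specOver_quotient_ker_pi_ptEquiv_hom (G := G) u
  haveI : IsIso v := Over.isIso_of_isClosedImmersion_of_finrank_eq v fun s => by
    rw [finrank_specOver_quotient_ker_pi_ptEquiv_hom u hu s, hrk s]
  exact ⟨asIso v, hv⟩

/-- Points form of (i): under the same hypotheses EVERY `R`-point of `G₀` is an `R`-point of the closure of `u`, and conversely — the closure
and `G₀` have the same points (in particular `C_can ⊆` closure and the closure adds no new `R`-points beyond `G₀(R)`).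
[cite: SerreTate1968, §1 Lemma 1] [cite: Tate1997FiniteFlatGroupSchemes, (3.7)] -/
theorem exists_comp_quotIncl_iff_exists_comp_unitComponent [IsFinite G.hom] [Finite J] (hu : Function.Injective u)
    (hG₀ : ∀ i, ∃ v : specOver R R ⟶ G₀, v ≫ j = u i) (hrk : ∀ s, G₀.hom.finrank s = Nat.card J)
    {R' : Type u} [CommRing R'] [Algebra R R'] (w : specOver R R' ⟶ G) :
    (∃ x : specOver R R' ⟶ specOver R (Alg G ⧸ RingHom.ker (AlgHom.pi fun i => ptEquiv G R (u i) : Alg G →ₐ[R] (J → R)).toRingHom),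
        x ≫ quotIncl G _ = w) ↔ ∃ y : specOver R R' ⟶ G₀, y ≫ j = w := by
  obtain ⟨e, he⟩ := exists_iso_quotIncl_pointsIdeal_of_unitComponent j u hu hG₀ hrk
  constructor
  · rintro ⟨x, rfl⟩
    exact ⟨x ≫ e.hom, by rw [Category.assoc, he]⟩
  · rintro ⟨y, rfl⟩
    exact ⟨y ≫ e.inv, by rw [Category.assoc, ← he, Iso.inv_hom_id_assoc]⟩

end Canonical

/-! ## §4 (ii) The closure of a finite subgroup of sections meeting `G₀` trivially is ÉTALE (★ `exists_etale_closedSubgroup`, witness exposed) -/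

section Etale

variable (R) [HenselianLocalRing R] (G G₀ : Over (Spec (CommRingCat.of R))) [GrpObj G] [GrpObj G₀] (j : G₀ ⟶ G) [IsMonHom j]
  [IsOpenImmersion j.left] [IsClosedImmersion j.left] [ConnectedSpace G₀.left] [IsFinite G.hom] [IsAffine G.left]
  (C : Subgroup (𝟙_ (Over (Spec (CommRingCat.of R))) ⟶ G))

/-- **The evaluation map of a finite subgroup of sections meeting `G₀(R)` trivially is SURJECTIVE** `Γ(G) ↠ R^C` (distinct closed points —
★ `eq_of_comap_maximalIdeal_ptEquiv_eq` — and CRT ★ `surjective_pi_of_pairwise_comap_maximalIdeal_ne`).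
[cite: Tate1997FiniteFlatGroupSchemes, (3.7)] [cite: StacksProject, Tag 04GG] -/
theorem surjective_pi_ptEquiv_of_subgroup [Finite C] (hC₀ : ∀ s ∈ C, (∃ s₀ : 𝟙_ (Over (Spec (CommRingCat.of R))) ⟶ G₀, s₀ ≫ j = s) → s = 1) :
    Function.Surjective (AlgHom.pi fun s : C => ptEquiv G R ((unitIsoSpecOver (R := R)).inv ≫ (s : 𝟙_ (Over (Spec (CommRingCat.of R))) ⟶ G)) :
      Alg G →ₐ[R] (C → R)) :=
  Literature.RingTheory.Ideal.surjective_pi_of_pairwise_comap_maximalIdeal_ne _ fun i k hik h =>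
    hik (Subtype.ext (FiniteSubgroupOfSections.eq_of_comap_maximalIdeal_ptEquiv_eq R G G₀ j C hC₀ i.2 k.2 h))

/-- **(ii) THE CLOSURE OF A NON-CANONICAL SUBGROUP IS FINITE ÉTALE.**  `R` henselian local, `G` finite over `Spec R` with unit component
`j : G₀ ↪ G`, `C ≤ G(R)` a finite subgroup of sections with `C ∩ G₀(R) = 1` (record: a stable line `C ≠ C_can`): the closure
`Spec (Γ(G) ⧸ I_C) → Spec R` of its points ideal is FINITE and ÉTALE, `I_C` is a HOPF ideal (so the closure is a closed subgroup scheme, ★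
`exists_grpObj_isMonHom_quotIncl`), and the `R`-points of `G` through it are EXACTLY the points of `C` — ★ `exists_etale_closedSubgroup` with
the witness `Cbar := Spec (Γ(G) ⧸ I_C)` exposed, so that it is comparable with (i).  (With ★ E1′
`isIso_unit_of_subsingleton_of_isClosedImmersion_of_etale` its special fibre contains no one-point closed subgroup but the trivial one:
«`sp C ≠ ker F`».) [cite: SerreTate1968, §1 Lemma 1] [cite: Tate1997FiniteFlatGroupSchemes, (3.7)] [cite: StacksProject, Tag 04GG] -/
theorem etale_quotIncl_pointsIdeal_of_subgroup (hC : (C : Set (𝟙_ (Over (Spec (CommRingCat.of R))) ⟶ G)).Finite)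
    (hC₀ : ∀ s ∈ C, (∃ s₀ : 𝟙_ (Over (Spec (CommRingCat.of R))) ⟶ G₀, s₀ ≫ j = s) → s = 1) :
    haveI : Finite C := hC.to_subtype
    IsFinite (specOver R (Alg G ⧸ RingHom.ker (AlgHom.pi fun s : C =>
        ptEquiv G R ((unitIsoSpecOver (R := R)).inv ≫ (s : 𝟙_ (Over (Spec (CommRingCat.of R))) ⟶ G)) : Alg G →ₐ[R] (C → R)).toRingHom)).hom ∧
      Etale (specOver R (Alg G ⧸ RingHom.ker (AlgHom.pi fun s : C =>
        ptEquiv G R ((unitIsoSpecOver (R := R)).inv ≫ (s : 𝟙_ (Over (Spec (CommRingCat.of R))) ⟶ G)) : Alg G →ₐ[R] (C → R)).toRingHom)).hom ∧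
      (RingHom.ker (AlgHom.pi fun s : C =>
        ptEquiv G R ((unitIsoSpecOver (R := R)).inv ≫ (s : 𝟙_ (Over (Spec (CommRingCat.of R))) ⟶ G)) :
          Alg G →ₐ[R] (C → R)).toRingHom).IsHopfIdeal R ∧
      ∀ w : specOver R R ⟶ G,
        (∃ x : specOver R R ⟶ specOver R (Alg G ⧸ RingHom.ker (AlgHom.pi fun s : C =>
            ptEquiv G R ((unitIsoSpecOver (R := R)).inv ≫ (s : 𝟙_ (Over (Spec (CommRingCat.of R))) ⟶ G)) : Alg G →ₐ[R] (C → R)).toRingHom),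
          x ≫ quotIncl G _ = w) ↔
        ∃ s : C, w = (unitIsoSpecOver (R := R)).inv ≫ (s : 𝟙_ (Over (Spec (CommRingCat.of R))) ⟶ G) := by
  haveI : Finite C := hC.to_subtype
  have hπ := surjective_pi_ptEquiv_of_subgroup R G G₀ j C hC₀
  have hone : ∃ i : C, (unitIsoSpecOver (R := R)).inv ≫ (i : 𝟙_ (Over (Spec (CommRingCat.of R))) ⟶ G) = 1 :=
    ⟨⟨1, C.one_mem⟩, MonObj.comp_one _⟩
  have hmul : ∀ i k : C, ∃ l : C, (unitIsoSpecOver (R := R)).inv ≫ (l : 𝟙_ (Over (Spec (CommRingCat.of R))) ⟶ G) =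
      ((unitIsoSpecOver (R := R)).inv ≫ (i : 𝟙_ _ ⟶ G)) * ((unitIsoSpecOver (R := R)).inv ≫ (k : 𝟙_ _ ⟶ G)) :=
    fun i k => ⟨⟨i.1 * k.1, C.mul_mem i.2 k.2⟩, MonObj.comp_mul _ _ _⟩
  have hinv : ∀ i : C, ∃ l : C, (unitIsoSpecOver (R := R)).inv ≫ (l : 𝟙_ (Over (Spec (CommRingCat.of R))) ⟶ G) =
      ((unitIsoSpecOver (R := R)).inv ≫ (i : 𝟙_ _ ⟶ G))⁻¹ :=
    fun i => ⟨⟨i.1⁻¹, C.inv_mem i.2⟩, GrpObj.comp_inv _ _⟩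
  exact ⟨isFinite_specOver_quotient_ker_hom _ hπ, etale_specOver_quotient_ker_hom _ hπ, isHopfIdeal_ker_pi G _ hπ hone hmul hinv,
    fun w => exists_comp_quotIncl_ker_pi_iff G _ hπ w⟩

end Etale

end AffineGroupScheme

end Literature.AlgebraicGeometry.GroupSchemes

end
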